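import Literature.MathematicalPhysics.QuantumManyBody.BogoliubovExpansion
import HarnessLib

/-!
# The cubic block `ℒ⁽³⁾` of the Weyl-reduced quartic form in triple form

Topic `Literature/MathematicalPhysics/QuantumManyBody`, namespace `BoseGas.Fock`; theorem-only sequel
of `BogoliubovExpansion.lean` for the provefact
`Literature.MathematicalPhysics.QuantumManyBody.BoseGas.BastiCenatiempoSchlein2021_upperBound`
(§4 of [BastiCenatiempoSchlein2021], the cubic terms `T*_νℒ^{(3)}_NT_ν = 𝒞_N + F₁ + F₂ + F₃ + …`).

The `√N₀`-block of `sum_pairCoeff_fockInner_conjPair_conjPair` consists of four momentum sums of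
cubic pairings `⟨B_qB_pξ, B_{q'}ξ⟩`, `⟨B_qξ, B_{q'}B_{p'}ξ⟩`. For a vector graded by a constant weight
`g ≠ 0` only the words `a†a†a†` and `aaa` survive (`fockInner_bogAn_bogAn_bogAn_of_graded`), and after
reindexing along the involution `σ` (`e ∘ σ = -e`) every one of the eight pieces becomes a
zero-momentum triple sum against the **cubic expectations**
`T(i,j,k) = ⟨ξ, a†_ia†_ja†_kξ⟩` and `T̄(i,j,k) = ⟨a†_ia†_ja†_kξ, ξ⟩` (`L3_block_eq`):
`ℒ⁽³⁾ = ∑_{e i+e j+e k=0} [(W(-e k)+W(e j))γ_iσ_jσ_k + (W(-e i)+W(e j))γ_iγ_jσ_k] T(i,j,k) + (h.c.)`.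
For the cubic vector these triple sums are evaluated by
`CubicTrialVectorCubicTerms.sum_mul_cubicExp_eq_sum_triples` (the `γγσ`-terms with `σ` at the soft
slot are `𝒞_N`, the others `F₁`–`F₃` of [ibid.]).

## References

* [BastiCenatiempoSchlein2021] G. Basti, S. Cenatiempo, B. Schlein, Forum Math. Sigma 9 (2021) e74,
  arXiv:2101.06222: (3.2) (`ℒ^{(3)}_N`), §4 (`T*_νℒ^{(3)}_NT_ν`, the terms `𝒞_N`, `F₁`, `F₂`, `F₃`).
-/

noncomputable section

namespace Literature.MathematicalPhysics.QuantumManyBody.BoseGas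

open Complex MvPolynomial Finset
open scoped ComplexConjugate BigOperators

namespace Fock

section L3

variable {ι : Type*} [Fintype ι] [DecidableEq ι] {σ : ι → ι} {P : Finset ι} {t : ι → ℝ} {e : ι → Momentum}

omit [DecidableEq ι] in
/-- Reindexing a sum along an involution (any additive commutative monoid). [folklore] -/
theorem sum_comp_involutive'' {β : Type*} [AddCommMonoid β] (hσ : Function.Involutive σ) (f : ι → β) :
    ∑ p, f (σ p) = ∑ p, f p :=
  Equiv.sum_comp (hσ.toPerm σ) f

omit [Fintype ι] [DecidableEq ι] in
/-- `⟨ξ, X_iX_jX_kξ⟩ = ⟨∂_k∂_j∂_iξ, ξ⟩`. [folklore] -/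
theorem fockInner_self_X_mul_X_mul_X_mul (i j k : ι) (ξ : MvPolynomial ι ℂ) :
    fockInner ξ (X i * (X j * (X k * ξ))) = fockInner (pderiv k (pderiv j (pderiv i ξ))) ξ := by
  rw [fockInner_X_mul_right, fockInner_X_mul_right, fockInner_X_mul_right]

omit [Fintype ι] [DecidableEq ι] in
/-- `⟨X_iX_jX_kξ, ξ⟩ = ⟨ξ, ∂_k∂_j∂_iξ⟩`. [folklore] -/
theorem fockInner_X_mul_X_mul_X_mul_self (i j k : ι) (ξ : MvPolynomial ι ℂ) :
    fockInner (X i * (X j * (X k * ξ))) ξ = fockInner ξ (pderiv k (pderiv j (pderiv i ξ))) := by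
  rw [fockInner_X_mul_left, fockInner_X_mul_left, fockInner_X_mul_left]

/-- **The third cubic sum in triple form**:
`∑_{e q = e p'+e q'} W(e p')⟨B_qξ, B_{q'}B_{p'}ξ⟩
  = ∑_{e i+e j+e k=0} [W(-e k)γ_iσ_jσ_k ⟨ξ,X_iX_jX_kξ⟩ + W(e i)γ_iγ_jσ_k ⟨X_iX_jX_kξ,ξ⟩]`.
[cite: BastiCenatiempoSchlein2021, §4 (`T*_νℒ^{(3)}_NT_ν`)] -/
theorem L3_sum₃_eq {M : Type*} [AddCommGroup M] {g : M} (h1 : g ≠ 0)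
    (hσ : Function.Involutive σ) (hP : ∀ p ∈ P, σ p ∉ P) (heσ : ∀ p, e (σ p) = -e p)
    (W : Momentum → ℂ) {ξ : MvPolynomial ι ℂ} {m : M} (hξ : IsWeightedHomogeneous (fun _ : ι => g) ξ m) :
    ∑ q, ∑ p', ∑ q', (if e q = e p' + e q' then
        W (e p') * fockInner (bogAn σ P t q ξ) (bogAn σ P t q' (bogAn σ P t p' ξ)) else 0) =
      ∑ i, ∑ j, ∑ k, (if e i + e j + e k = 0 then
        W (-e k) * ((bogGamma σ P t i * bogSigma σ P t j * bogSigma σ P t k : ℝ) : ℂ) *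
            fockInner ξ (X i * (X j * (X k * ξ))) +
          W (e i) * ((bogGamma σ P t i * bogGamma σ P t j * bogSigma σ P t k : ℝ) : ℂ) *
            fockInner (X i * (X j * (X k * ξ))) ξ else 0) := by
  -- expand and split
  have hsplit : ∀ (c : Prop) [Decidable c] (x y : ℂ), (if c then x + y else 0) = (if c then x else 0) + (if c then y else 0) := by
    intro c _ x y; split_ifs <;> simp
  simp only [fockInner_bogAn_bogAn_bogAn_of_graded h1 hξ, mul_add, hsplit, Finset.sum_add_distrib]
  congr 1
  · -- first piece: swap `(p', q')`, then `q' ↦ σ j`, `p' ↦ σ k`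
    refine Finset.sum_congr rfl fun q _ => ?_
    rw [Finset.sum_comm, ← sum_comp_involutive'' hσ]
    refine Finset.sum_congr rfl fun j _ => ?_
    rw [← sum_comp_involutive'' hσ]
    refine Finset.sum_congr rfl fun k _ => ?_
    by_cases hc : e q + e j + e k = 0
    · have hc' : e q = e (σ k) + e (σ j) := by
        rw [heσ, heσ, ← sub_eq_zero]
        have : e q - (-e k + -e j) = e q + e j + e k := by abel
        rw [this]; exact hc
      rw [if_pos hc', if_pos hc]
      simp only [hσ _, heσ, bogSigma_partner hσ hP, fockInner_self_X_mul_X_mul_X_mul]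
      push_cast; ring
    · have hc' : ¬ (e q = e (σ k) + e (σ j)) := by
        intro h; apply hc
        rw [heσ, heσ] at h
        rw [h]; abel
      rw [if_neg hc', if_neg hc]
  · -- second piece: `q ↦ σ k`, then reorder `(k, p', q') → (p', q', k)`
    rw [← sum_comp_involutive'' hσ]
    rw [Finset.sum_comm]
    refine Finset.sum_congr rfl fun p' _ => ?_
    rw [Finset.sum_comm]
    refine Finset.sum_congr rfl fun q' _ => Finset.sum_congr rfl fun k _ => ?_
    by_cases hc : e p' + e q' + e k = 0
    · have hc' : e (σ k) = e p' + e q' := by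
        rw [heσ, ← sub_eq_zero]
        have : -e k - (e p' + e q') = -(e p' + e q' + e k) := by abel
        rw [this, hc, neg_zero]
      rw [if_pos hc', if_pos hc]
      simp only [hσ _, bogSigma_partner hσ hP, fockInner_X_mul_X_mul_X_mul_self]
      push_cast; ring
    · have hc' : ¬ (e (σ k) = e p' + e q') := by
        intro h; apply hc
        rw [heσ] at h
        rw [← h]; abel
      rw [if_neg hc', if_neg hc]

/-- **The fourth cubic sum in triple form**:
`∑_{e p = e p'+e q'} W(e p'-e p)⟨B_pξ, B_{q'}B_{p'}ξ⟩
  = ∑_{e i+e j+e k=0} [W(e j)γ_iσ_jσ_k ⟨ξ,X_iX_jX_kξ⟩ + W(-e j)γ_iγ_jσ_k ⟨X_iX_jX_kξ,ξ⟩]`.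
[cite: BastiCenatiempoSchlein2021, §4 (`T*_νℒ^{(3)}_NT_ν`)] -/
theorem L3_sum₄_eq {M : Type*} [AddCommGroup M] {g : M} (h1 : g ≠ 0)
    (hσ : Function.Involutive σ) (hP : ∀ p ∈ P, σ p ∉ P) (heσ : ∀ p, e (σ p) = -e p)
    (W : Momentum → ℂ) {ξ : MvPolynomial ι ℂ} {m : M} (hξ : IsWeightedHomogeneous (fun _ : ι => g) ξ m) :
    ∑ p, ∑ p', ∑ q', (if e p = e p' + e q' then
        W (e p' - e p) * fockInner (bogAn σ P t p ξ) (bogAn σ P t q' (bogAn σ P t p' ξ)) else 0) =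
      ∑ i, ∑ j, ∑ k, (if e i + e j + e k = 0 then
        W (e j) * ((bogGamma σ P t i * bogSigma σ P t j * bogSigma σ P t k : ℝ) : ℂ) *
            fockInner ξ (X i * (X j * (X k * ξ))) +
          W (-e j) * ((bogGamma σ P t i * bogGamma σ P t j * bogSigma σ P t k : ℝ) : ℂ) *
            fockInner (X i * (X j * (X k * ξ))) ξ else 0) := by
  have hsplit : ∀ (c : Prop) [Decidable c] (x y : ℂ), (if c then x + y else 0) = (if c then x else 0) + (if c then y else 0) := by
    intro c _ x y; split_ifs <;> simp
  simp only [fockInner_bogAn_bogAn_bogAn_of_graded h1 hξ, mul_add, hsplit, Finset.sum_add_distrib]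
  congr 1
  · refine Finset.sum_congr rfl fun p _ => ?_
    rw [Finset.sum_comm, ← sum_comp_involutive'' hσ]
    refine Finset.sum_congr rfl fun j _ => ?_
    rw [← sum_comp_involutive'' hσ]
    refine Finset.sum_congr rfl fun k _ => ?_
    by_cases hc : e p + e j + e k = 0
    · have hc' : e p = e (σ k) + e (σ j) := by
        rw [heσ, heσ, ← sub_eq_zero]
        have : e p - (-e k + -e j) = e p + e j + e k := by abel
        rw [this]; exact hc
      have hW : e (σ k) - e p = e j := by
        rw [heσ, ← sub_eq_zero]
        have : -e k - e p - e j = -(e p + e j + e k) := by abel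
        rw [this, hc, neg_zero]
      rw [if_pos hc', if_pos hc, hW]
      simp only [hσ _, bogSigma_partner hσ hP, fockInner_self_X_mul_X_mul_X_mul]
      push_cast; ring
    · have hc' : ¬ (e p = e (σ k) + e (σ j)) := by
        intro h; apply hc
        rw [heσ, heσ] at h
        rw [h]; abel
      rw [if_neg hc', if_neg hc]
  · rw [← sum_comp_involutive'' hσ]
    rw [Finset.sum_comm]
    refine Finset.sum_congr rfl fun p' _ => ?_
    rw [Finset.sum_comm]
    refine Finset.sum_congr rfl fun q' _ => Finset.sum_congr rfl fun k _ => ?_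
    by_cases hc : e p' + e q' + e k = 0
    · have hc' : e (σ k) = e p' + e q' := by
        rw [heσ, ← sub_eq_zero]
        have : -e k - (e p' + e q') = -(e p' + e q' + e k) := by abel
        rw [this, hc, neg_zero]
      have hW : e p' - e (σ k) = -e q' := by
        rw [heσ, ← sub_eq_zero]
        have : e p' - -e k - -e q' = e p' + e q' + e k := by abel
        rw [this, hc]
      rw [if_pos hc', if_pos hc, hW]
      simp only [hσ _, bogSigma_partner hσ hP, fockInner_X_mul_X_mul_X_mul_self]
      push_cast; ring
    · have hc' : ¬ (e (σ k) = e p' + e q') := by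
        intro h; apply hc
        rw [heσ] at h
        rw [← h]; abel
      rw [if_neg hc', if_neg hc]

omit [DecidableEq ι] in
/-- Reversing a triple sum. [folklore] -/
theorem sum_comm₃_rev {β : Type*} [AddCommMonoid β] (f : ι → ι → ι → β) :
    ∑ a, ∑ b, ∑ c, f a b c = ∑ c, ∑ b, ∑ a, f a b c := by
  rw [Finset.sum_comm]
  have h : ∀ b, ∑ a, ∑ c, f a b c = ∑ c, ∑ a, f a b c := fun b => Finset.sum_comm
  simp only [h]
  rw [Finset.sum_comm]

/-- **The first cubic sum in triple form**:
`∑_{e p+e q = e q'} W(-e p)⟨B_qB_pξ, B_{q'}ξ⟩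
  = ∑_{e i+e j+e k=0} [W(-e i)γ_iγ_jσ_k ⟨ξ,X_iX_jX_kξ⟩ + W(e k)γ_iσ_jσ_k ⟨X_iX_jX_kξ,ξ⟩]`.
[cite: BastiCenatiempoSchlein2021, §4 (`T*_νℒ^{(3)}_NT_ν`)] -/
theorem L3_sum₁_eq {M : Type*} [AddCommGroup M] {g : M} (h1 : g ≠ 0)
    (hσ : Function.Involutive σ) (hP : ∀ p ∈ P, σ p ∉ P) (heσ : ∀ p, e (σ p) = -e p)
    (W : Momentum → ℂ) {ξ : MvPolynomial ι ℂ} {m : M} (hξ : IsWeightedHomogeneous (fun _ : ι => g) ξ m) :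
    ∑ p, ∑ q, ∑ q', (if e p + e q = e q' then
        W (-e p) * fockInner (bogAn σ P t q (bogAn σ P t p ξ)) (bogAn σ P t q' ξ) else 0) =
      ∑ i, ∑ j, ∑ k, (if e i + e j + e k = 0 then
        W (-e i) * ((bogGamma σ P t i * bogGamma σ P t j * bogSigma σ P t k : ℝ) : ℂ) *
            fockInner ξ (X i * (X j * (X k * ξ))) +
          W (e k) * ((bogGamma σ P t i * bogSigma σ P t j * bogSigma σ P t k : ℝ) : ℂ) *
            fockInner (X i * (X j * (X k * ξ))) ξ else 0) := by
  have hsplit : ∀ (c : Prop) [Decidable c] (x y : ℂ), (if c then x + y else 0) = (if c then x else 0) + (if c then y else 0) := by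
    intro c _ x y; split_ifs <;> simp
  have hconj : ∀ p q q', fockInner (bogAn σ P t q (bogAn σ P t p ξ)) (bogAn σ P t q' ξ) =
      ((bogGamma σ P t q' * (bogSigma σ P t q * bogSigma σ P t p) : ℝ) : ℂ) *
        fockInner ξ (pderiv (σ p) (pderiv (σ q) (pderiv q' ξ))) +
      ((bogSigma σ P t q' * (bogGamma σ P t q * bogGamma σ P t p) : ℝ) : ℂ) *
        fockInner (pderiv (σ q') (pderiv q (pderiv p ξ))) ξ := by
    intro p q q'
    rw [← conj_fockInner, fockInner_bogAn_bogAn_bogAn_of_graded h1 hξ, map_add, map_mul, map_mul,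
      Complex.conj_ofReal, Complex.conj_ofReal, conj_fockInner, conj_fockInner]
  simp only [hconj, mul_add, hsplit, Finset.sum_add_distrib]
  rw [add_comm]
  congr 1
  · -- `σ_{q'}γ_qγ_p ⟨∂_{σq'}∂_q∂_pξ, ξ⟩`: direct order, `q' ↦ σ k`
    refine Finset.sum_congr rfl fun p _ => Finset.sum_congr rfl fun q _ => ?_
    rw [← sum_comp_involutive'' hσ]
    refine Finset.sum_congr rfl fun k _ => ?_
    by_cases hc : e p + e q + e k = 0
    · have hc' : e p + e q = e (σ k) := by
        rw [heσ, ← sub_eq_zero]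
        have : e p + e q - -e k = e p + e q + e k := by abel
        rw [this, hc]
      rw [if_pos hc', if_pos hc]
      simp only [hσ _, bogSigma_partner hσ hP, fockInner_self_X_mul_X_mul_X_mul]
      push_cast; ring
    · have hc' : ¬ (e p + e q = e (σ k)) := by
        intro h; apply hc
        rw [heσ] at h
        have : e p + e q + e k = (e p + e q) + e k := by abel
        rw [this, h]; abel
      rw [if_neg hc', if_neg hc]
  · -- `γ_{q'}σ_qσ_p ⟨ξ, ∂_{σp}∂_{σq}∂_{q'}ξ⟩`: reverse the order, `q ↦ σ j`, `p ↦ σ k`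
    rw [sum_comm₃_rev]
    refine Finset.sum_congr rfl fun q' _ => ?_
    rw [← sum_comp_involutive'' hσ]
    refine Finset.sum_congr rfl fun j _ => ?_
    rw [← sum_comp_involutive'' hσ]
    refine Finset.sum_congr rfl fun k _ => ?_
    by_cases hc : e q' + e j + e k = 0
    · have hc' : e (σ k) + e (σ j) = e q' := by
        rw [heσ, heσ, ← sub_eq_zero]
        have : -e k + -e j - e q' = -(e q' + e j + e k) := by abel
        rw [this, hc, neg_zero]
      rw [if_pos hc', if_pos hc]
      simp only [hσ _, heσ, neg_neg, bogSigma_partner hσ hP, fockInner_X_mul_X_mul_X_mul_self]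
      push_cast; ring
    · have hc' : ¬ (e (σ k) + e (σ j) = e q') := by
        intro h; apply hc
        rw [heσ, heσ] at h
        rw [← h]; abel
      rw [if_neg hc', if_neg hc]

/-- **The second cubic sum in triple form**:
`∑_{e p+e q = e p'} W(e p'-e p)⟨B_qB_pξ, B_{p'}ξ⟩
  = ∑_{e i+e j+e k=0} [W(e j)γ_iγ_jσ_k ⟨ξ,X_iX_jX_kξ⟩ + W(-e j)γ_iσ_jσ_k ⟨X_iX_jX_kξ,ξ⟩]`.
[cite: BastiCenatiempoSchlein2021, §4 (`T*_νℒ^{(3)}_NT_ν`)] -/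
theorem L3_sum₂_eq {M : Type*} [AddCommGroup M] {g : M} (h1 : g ≠ 0)
    (hσ : Function.Involutive σ) (hP : ∀ p ∈ P, σ p ∉ P) (heσ : ∀ p, e (σ p) = -e p)
    (W : Momentum → ℂ) {ξ : MvPolynomial ι ℂ} {m : M} (hξ : IsWeightedHomogeneous (fun _ : ι => g) ξ m) :
    ∑ p, ∑ q, ∑ p', (if e p + e q = e p' then
        W (e p' - e p) * fockInner (bogAn σ P t q (bogAn σ P t p ξ)) (bogAn σ P t p' ξ) else 0) =
      ∑ i, ∑ j, ∑ k, (if e i + e j + e k = 0 then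
        W (e j) * ((bogGamma σ P t i * bogGamma σ P t j * bogSigma σ P t k : ℝ) : ℂ) *
            fockInner ξ (X i * (X j * (X k * ξ))) +
          W (-e j) * ((bogGamma σ P t i * bogSigma σ P t j * bogSigma σ P t k : ℝ) : ℂ) *
            fockInner (X i * (X j * (X k * ξ))) ξ else 0) := by
  have hsplit : ∀ (c : Prop) [Decidable c] (x y : ℂ), (if c then x + y else 0) = (if c then x else 0) + (if c then y else 0) := by
    intro c _ x y; split_ifs <;> simp
  have hconj : ∀ p q q', fockInner (bogAn σ P t q (bogAn σ P t p ξ)) (bogAn σ P t q' ξ) =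
      ((bogGamma σ P t q' * (bogSigma σ P t q * bogSigma σ P t p) : ℝ) : ℂ) *
        fockInner ξ (pderiv (σ p) (pderiv (σ q) (pderiv q' ξ))) +
      ((bogSigma σ P t q' * (bogGamma σ P t q * bogGamma σ P t p) : ℝ) : ℂ) *
        fockInner (pderiv (σ q') (pderiv q (pderiv p ξ))) ξ := by
    intro p q q'
    rw [← conj_fockInner, fockInner_bogAn_bogAn_bogAn_of_graded h1 hξ, map_add, map_mul, map_mul,
      Complex.conj_ofReal, Complex.conj_ofReal, conj_fockInner, conj_fockInner]
  simp only [hconj, mul_add, hsplit, Finset.sum_add_distrib]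
  rw [add_comm]
  congr 1
  · -- `σ_{p'}γ_qγ_p ⟨∂_{σp'}∂_q∂_pξ, ξ⟩ W(e q)`: direct order, `p' ↦ σ k`
    refine Finset.sum_congr rfl fun p _ => Finset.sum_congr rfl fun q _ => ?_
    rw [← sum_comp_involutive'' hσ]
    refine Finset.sum_congr rfl fun k _ => ?_
    by_cases hc : e p + e q + e k = 0
    · have hc' : e p + e q = e (σ k) := by
        rw [heσ, ← sub_eq_zero]
        have : e p + e q - -e k = e p + e q + e k := by abel
        rw [this, hc]
      have hW : e (σ k) - e p = e q := by
        rw [heσ, ← sub_eq_zero]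
        have : -e k - e p - e q = -(e p + e q + e k) := by abel
        rw [this, hc, neg_zero]
      rw [if_pos hc', if_pos hc, hW]
      simp only [hσ _, bogSigma_partner hσ hP, fockInner_self_X_mul_X_mul_X_mul]
      push_cast; ring
    · have hc' : ¬ (e p + e q = e (σ k)) := by
        intro h; apply hc
        rw [heσ] at h
        have : e p + e q + e k = (e p + e q) + e k := by abel
        rw [this, h]; abel
      rw [if_neg hc', if_neg hc]
  · -- `γ_{p'}σ_qσ_p ⟨ξ, ∂_{σp}∂_{σq}∂_{p'}ξ⟩ W(e q)`: reverse, `q ↦ σ j`, `p ↦ σ k`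
    rw [sum_comm₃_rev]
    refine Finset.sum_congr rfl fun p' _ => ?_
    rw [← sum_comp_involutive'' hσ]
    refine Finset.sum_congr rfl fun j _ => ?_
    rw [← sum_comp_involutive'' hσ]
    refine Finset.sum_congr rfl fun k _ => ?_
    by_cases hc : e p' + e j + e k = 0
    · have hc' : e (σ k) + e (σ j) = e p' := by
        rw [heσ, heσ, ← sub_eq_zero]
        have : -e k + -e j - e p' = -(e p' + e j + e k) := by abel
        rw [this, hc, neg_zero]
      have hW : e p' - e (σ k) = -e j := by
        rw [heσ, ← sub_eq_zero]
        have : e p' - -e k - -e j = e p' + e j + e k := by abel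
        rw [this, hc]
      rw [if_pos hc', if_pos hc, hW]
      simp only [hσ _, bogSigma_partner hσ hP, fockInner_X_mul_X_mul_X_mul_self]
      push_cast; ring
    · have hc' : ¬ (e (σ k) + e (σ j) = e p') := by
        intro h; apply hc
        rw [heσ, heσ] at h
        rw [← h]; abel
      rw [if_neg hc', if_neg hc]

/-- **The cubic block `ℒ⁽³⁾` in triple form.** For a vector graded by a constant weight `g ≠ 0`,
even pair data and momentum labels with `e ∘ σ = -e`, the `√N₀`-block of the Weyl-reduced quartic
form (`sum_pairCoeff_fockInner_conjPair_conjPair`) is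
`∑_{e i+e j+e k=0} {[(W(-e k)+W(e j))γ_iσ_jσ_k + (W(-e i)+W(e j))γ_iγ_jσ_k] ⟨ξ, a†_ia†_ja†_kξ⟩`
`+ [(W(e k)+W(-e j))γ_iσ_jσ_k + (W(e i)+W(-e j))γ_iγ_jσ_k] ⟨a†_ia†_ja†_kξ, ξ⟩}` — the cubic
operator `a†a†a† + h.c.` of `T*_νℒ^{(3)}_NT_ν` with its coefficients (`𝒞_N`: `γγσ` with `σ` at the
soft slot; `F₁`–`F₃`: the others).
[cite: BastiCenatiempoSchlein2021, §4 (`T*_νℒ^{(3)}_NT_ν = 𝒞_N + F₁ + F₂ + F₃ + …`)] -/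
theorem L3_block_eq {M : Type*} [AddCommGroup M] {g : M} (h1 : g ≠ 0)
    (hσ : Function.Involutive σ) (hP : ∀ p ∈ P, σ p ∉ P) (heσ : ∀ p, e (σ p) = -e p)
    (W : Momentum → ℂ) {ξ : MvPolynomial ι ℂ} {m : M} (hξ : IsWeightedHomogeneous (fun _ : ι => g) ξ m) :
    (∑ p, ∑ q, ∑ q', if e p + e q = e q' then
        W (-e p) * fockInner (bogAn σ P t q (bogAn σ P t p ξ)) (bogAn σ P t q' ξ) else 0) +
      (∑ p, ∑ q, ∑ p', if e p + e q = e p' then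
        W (e p' - e p) * fockInner (bogAn σ P t q (bogAn σ P t p ξ)) (bogAn σ P t p' ξ) else 0) +
      (∑ q, ∑ p', ∑ q', if e q = e p' + e q' then
        W (e p') * fockInner (bogAn σ P t q ξ) (bogAn σ P t q' (bogAn σ P t p' ξ)) else 0) +
      (∑ p, ∑ p', ∑ q', if e p = e p' + e q' then
        W (e p' - e p) * fockInner (bogAn σ P t p ξ) (bogAn σ P t q' (bogAn σ P t p' ξ)) else 0) =
      ∑ i, ∑ j, ∑ k, (if e i + e j + e k = 0 then
        ((W (-e k) + W (e j)) * ((bogGamma σ P t i * bogSigma σ P t j * bogSigma σ P t k : ℝ) : ℂ) +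
            (W (-e i) + W (e j)) * ((bogGamma σ P t i * bogGamma σ P t j * bogSigma σ P t k : ℝ) : ℂ)) *
          fockInner ξ (X i * (X j * (X k * ξ))) +
        ((W (e k) + W (-e j)) * ((bogGamma σ P t i * bogSigma σ P t j * bogSigma σ P t k : ℝ) : ℂ) +
            (W (e i) + W (-e j)) * ((bogGamma σ P t i * bogGamma σ P t j * bogSigma σ P t k : ℝ) : ℂ)) *
          fockInner (X i * (X j * (X k * ξ))) ξ else 0) := by
  rw [L3_sum₁_eq h1 hσ hP heσ W hξ, L3_sum₂_eq h1 hσ hP heσ W hξ, L3_sum₃_eq h1 hσ hP heσ W hξ,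
    L3_sum₄_eq h1 hσ hP heσ W hξ]
  simp only [← Finset.sum_add_distrib]
  refine Finset.sum_congr rfl fun i _ => Finset.sum_congr rfl fun j _ => Finset.sum_congr rfl fun k _ => ?_
  split_ifs <;> ring

end L3

end Fock

end Literature.MathematicalPhysics.QuantumManyBody.BoseGas

end
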